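import Summits.QuantumFields.BalabanUV.T4Continuum.Support.NE7OneStepOfRoutePi
import Summits.QuantumFields.BalabanUV.T4Continuum.Support.NE7SegmentPlaquetteRadius
import Summits.QuantumFields.BalabanUV.T4Continuum.Support.NE3ResidualSliceRep
import Summits.QuantumFields.BalabanUV.T4Continuum.Support.NE3EnergyHessBilin
import Summits.QuantumFields.BalabanUV.T4Continuum.Support.NE7ExactCurrent
import Summits.QuantumFields.BalabanUV.T4Continuum.Support.NE3EnergyHessTwoTerm
import HarnessLib

/-!
# NE7ApeFlatSkeleton — (APE)'s FIRST FILE: the a-priori estimate as a KERNEL COMPOSITION at a FLAT reference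
# ([Balaban1985Variational] Sect. F pp. 300–305 transposed to the T⁴ dictionary), over DISPLAYED letters in their honest currencies

Cell `pub-balaban`, rung (B)+1 sub-cell t4, lineage `b2b-balaban-t4-ne7-p1`, generation 70 (CRUX PROVER NE7 #1); hunt (h14), memo
`t4/b2b-balaban-t4-ne7-p1-g70/HUNT-H14-APE-FLAT-SKELETON.md`.  File F38 (over F31 `NE7OneStepOfRoutePi`, whose `hape` hypothesis §4 produces); 8 thm.

THE READING ([Balaban1985Variational] Sect. F, p. 300 «we will use only the fact that they are critical configurations»; p. 302 «all the
operators in this section are taken without any external gauge field configuration»).  The a-priori estimate of a tangent-critical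
admissible `U` is organised at a FLAT reference `F̃`: a gauge `u` with `U^u = F̃e^{A}`, `‖A‖ ≤ α₀` (B8 Thm 2 TYPE, (152)); the split (159)
`A = A_T + A_N`, `A_N = H(D_{F̃}A)` the image of the linearised average under the flat LANDAU lift `H` — EXACT (`D_{F̃}A_N = D_{F̃}A`), with
the curl letter (R7) (`‖d_{F̃}A_N‖ ≤ C_R·M⁻²·`coarse curvature — LIN-ONE-STEP, gen 65, F37) and hess-ORTHOGONAL to the tangent space
((R⊥): `hess F̃ A_N Y = 0` for `D_{F̃}Y = 0` — «by the definition of H₀B … ⟨δA′, Δ_a H₀B⟩ = 0», p. 298); the tangent part `A_T ∈ T(F̃)` in the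
gauge slice `S` solves the projected critical equation whose source is an `(ℓ¹)*`-functional of density `τ + ρ` (`ρ` = the expansion
remainder of the first variation at `F̃e^{A}` against the Hessian at `F̃`, (165)'s quadratic terms; `τ` = the defect of transporting tangent test
fields from `T(F̃)` to `T(F̃e^{A})`), and the SLICE SOLVER letter ((1.115)∕[Balaban1985PropagatorsII] Cor. 2.8 TYPE at `U = 1`: one
derivative of the slice Green's function of mass `∼ M⁻¹`) gives `sup‖d_{F̃}A_T‖ ≤ K·M·(τ + ρ)`; the flat Taylor bound turns `d_{F̃}A` into
plaquettes.  WHY (R⊥) (design point of this generation, memo H14 §2): WITHOUT it the normal part enters the tangent equation as a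
divergence-form source `⟨d A_N, d Y⟩` and the sup bound of `d A_T` would need an `ℓ^∞` Riesz-transform estimate (false by `log M`); WITH it the
cross term vanishes identically — Bałaban's choice of `H₀` as the `Δ_a`-minimiser.  CURRENCIES (§3, every `M = L^{k+1}` cancels):
`K_G = K·M`, `τ ≤ τ̂M⁻³`, `ρ ≤ ρ̂M⁻³`, `c_N ≤ C_R·ĝ·M⁻²`, `α₀ ≤ α̂M⁻¹` ⟹ radius `(K(τ̂+ρ̂) + C_Rĝ + 28α̂²)·M⁻²`; in nature `ρ̂ ∼ c(α̂α̂₁ + α̂³)`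
needs the GRADIENT bound `α̂₁M⁻²` of the representative (B8 (1.36) TYPE) and the cubic-vertex structure (memo H14 §3), `τ̂ ∼ c·δ·α̂`
(route Π's (R3) + F3's radius bound + the Lipschitz letter of `D_W` in `W`), `ĝ ∼ β′ + c″α̂²` (the datum's radius + the quadratic letter).

WHAT ([folklore] composition + two identities; 0 def, 0 sorry).
§1 **`hessPlaqAt_flat`** ∕ **`hess_flat`** (at a flat background the mixed Hessian IS the curl pairing `−Σ Re tr[(d Y)(d X)]`, by [tree]
   `NE3EnergyHessTwoTerm.nReTr_dcurlAt`), `norm_hol_vary_flat_sub_one_le` (plaquettes of `F̃e^{A}` within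
   `‖d_{F̃}A‖ + 28α₀²` of `1`), `curlAt_eq_add_of_split`.
§2 **`smallField_vary_of_flatLetters`** — THE POINTWISE BOOTSTRAP at the representative: `SmallField (F̃e^{A}) (K_G(τ+ρ) + c_N + 28α₀²)` from
   the normal-part letters (exactness, (R7) output, (R⊥) output), the slice membership of `A − A_N`, the slice solver letter, the expansion
   letter, criticality at the representative and the test-field transport letter.
§3 `smallField_of_flatLetters_gauge` (back to `U` through `U^u = F̃e^{A}`), `radius_currency` (every `M` cancels).
§4 **`hape_of_flatLetters`** — F29∕F31∕F33's `hape` hypothesis ON THE DATA CLASS `𝒟_β`, generic `d`, `L ≥ 1`, every `N`, from the letter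
   bundle quantified over `(D, k, U)` with uniform currencies `(K, τ̂, ρ̂, C_R, ĝ, α̂)`; `δ₁ ≥ K(τ̂+ρ̂) + C_Rĝ + 28α̂²`.
THE (APE)-BILL AFTER THIS FILE (each a named letter of §4, memo H14 §4): REP♭ = Π-L1♮ at the pair `(F̃, U)` with sup AND gradient currency +
criticality at the representative [B8 Thm 2 TYPE; gauge covariance of `dAction`∕`TangentIter` is tree: `dirIter_gaugeAct`, `fineAction_gaugeAct`];
LIFT♭ = the flat Landau lift at `F̃` (exact ∕ (R7) ∕ (R⊥)) [F36∕F37 + `B5Hk163RDiv.HkOp_minimum_curvature` at `F̃ = 1`; the commuting-holonomy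
twist open]; G♭ = the slice solver [B5 (1.115) ∕ B6 Cor. 2.8 TYPE at `U = 1`, bridge brick 5]; EXP = the strong expansion remainder [B11 (81)∕(142)
TYPE, lattice calculus]; TT = the test-field transport [route Π (R3) + F3 + Lipschitz of `D_W`]; the coarse curvature `ĝ` [tree-type].
HONEST FRAMING (page 1).  Composition over HYPOTHESES; NOTHING of REP♭, LIFT♭ (beyond `F̃ = 1`), G♭, EXP, TT is proved here; (APE) NOT proved;
NOT ONE-STEP, NOT NE7; spine 0∕9; finite T⁴ rung (B)+1 — NOT infinite volume, NOT mass gap, NOT Clay.  Continuum YM on T⁴ ⇐ BetaPertH ∧ nine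
spine estimates (0/9 proved); BetaPertH ⇐ (D1) ∧ (D4) ∧ CAP+tail; G-an2-4 gates asym, D1 and NE2/3/4.
-/

set_option autoImplicit false

open scoped BigOperators Matrix.Norms.L2Operator
open NormedSpace Finset Set

namespace Summit.QuantumFields.BalabanUV.T4Continuum.NE7ApeFlatSkeleton

open Literature.MathematicalPhysics.QuantumFieldTheory.Balaban1983to89
open B7Prop1Explicit B7Prop2Explicit MatrixLog UnitaryModel
open T4AveragingDeficitWall (IsUnitaryCfg IsSkewDir SmallField fineAction vary curl curlAt curlSq dirSq dirL1 vary_zero)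
open T4AveragingDeficitWallBoundary (IsPeriodicCfg periodBox)
open AveragingDeficitPeriodicCounting (IsPeriodicDir)
open AveragingDeficitMultiLevelPrep (LevelSmall TangentIter)
open MinimalActionLevels (perWin)
open MinimalActionSandwich (admissible)
open MinimalActionRate (sfClass SmallField.mono)
open NE3HessForm (hess hessPlaq hessPlaqAt dcurlAt dAction)
open NE3HessBounds (bondSqAt)
open NE3EnergyHessTwoTerm (nReTr_dcurlAt)
open NE3TangentCovariantTower (dirIter tangentIter_iff_dirIter_eq_zero)
open NE3ResidualSliceRep (dirIter_sub)
open NE3EnergyHessBilin (hess_add_left curlAt_add)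
open NE3EnergyShapes (IsUnitarySite)
open NE7SegmentPlaquetteRadius (norm_hol_taylor_le bondSqAt_le_of_sup)
open NE7ExactCurrent (dAction_add)
open NE7ConvOneStepWeightedUnique (smallField_of_gaugeAct_eq)

noncomputable section

variable {d : ℕ} {n : Type*} [Fintype n] [DecidableEq n]

/-! ## §1 Two elementary identities -/

/-- At a FLAT plaquette the plaquette variable of `F̃e^{A}` is within `‖(d_{F̃}A)(p′)‖ + 28α₀²` of `1` (`‖A‖ ≤ α₀`):
the Taylor bound `NE7SegmentPlaquetteRadius.norm_hol_taylor_le` between `s = 0` and `σ = 1` at a plaquette with `F̃(∂p′) = 1`. [folklore] -/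
theorem norm_hol_vary_flat_sub_one_le [Nonempty n] {V : Site d → Fin d → (Matrix n n ℂ)ˣ} (hV : IsUnitaryCfg V) (hV0 : SmallField V 0)
    {X : Site d → Fin d → Matrix n n ℂ} (hX : IsSkewDir X) {α : ℝ} (hXα : ∀ y κ, ‖X y κ‖ ≤ α) (z : Site d) {μ ν : Fin d} (hμν : μ ≠ ν) :
    ‖((hol (vary V X 1) z (plaqWord μ ν) : (Matrix n n ℂ)ˣ) : Matrix n n ℂ) - 1‖ ≤ ‖curlAt V X z μ ν‖ + 28 * α ^ 2 := by
  have h1 : ((hol V z (plaqWord μ ν) : (Matrix n n ℂ)ˣ) : Matrix n n ℂ) = 1 := by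
    have h := hV0 z μ ν hμν
    have : ‖((hol V z (plaqWord μ ν) : (Matrix n n ℂ)ˣ) : Matrix n n ℂ) - 1‖ = 0 := le_antisymm h (norm_nonneg _)
    exact sub_eq_zero.mp (norm_eq_zero.mp this)
  have hT := norm_hol_taylor_le hV hX z μ ν 0 1
  rw [vary_zero, h1] at hT
  simp only [sub_zero, one_smul, mul_one, one_pow] at hT
  have hb := bondSqAt_le_of_sup hXα z μ ν
  -- ‖h − 1‖ ≤ ‖h − 1 − c‖ + ‖c‖
  have htri : ‖((hol (vary V X 1) z (plaqWord μ ν) : (Matrix n n ℂ)ˣ) : Matrix n n ℂ) - 1‖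
      ≤ ‖((hol (vary V X 1) z (plaqWord μ ν) : (Matrix n n ℂ)ˣ) : Matrix n n ℂ) - 1 - curlAt V X z μ ν‖ + ‖curlAt V X z μ ν‖ := by
    have := norm_add_le (((hol (vary V X 1) z (plaqWord μ ν) : (Matrix n n ℂ)ˣ) : Matrix n n ℂ) - 1 - curlAt V X z μ ν) (curlAt V X z μ ν)
    simpa using this
  linarith

/-- **THE HESSIAN AT A FLAT BACKGROUND IS THE CURL PAIRING**: at a plaquette with `V(∂p′) = 1`,
`hessPlaqAt V X Y p′ = −Re tr[(d_V Y)(p′)·(d_V X)(p′)]` (the transported commutators are traceless). [folklore] -/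
theorem hessPlaqAt_flat {V : Site d → Fin d → (Matrix n n ℂ)ˣ} (hV0 : SmallField V 0) (X Y : Site d → Fin d → Matrix n n ℂ) (z : Site d)
    {μ ν : Fin d} (hμν : μ ≠ ν) : hessPlaqAt V X Y z μ ν = -nReTr (curlAt V Y z μ ν * curlAt V X z μ ν) := by
  have h1 : ((hol V z (plaqWord μ ν) : (Matrix n n ℂ)ˣ) : Matrix n n ℂ) = 1 := by
    have h := hV0 z μ ν hμν
    have : ‖((hol V z (plaqWord μ ν) : (Matrix n n ℂ)ˣ) : Matrix n n ℂ) - 1‖ = 0 := le_antisymm h (norm_nonneg _)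
    exact sub_eq_zero.mp (norm_eq_zero.mp this)
  unfold hessPlaqAt
  rw [h1, mul_one, T4TiltOscillation.nReTr_add, nReTr_dcurlAt, zero_add]

/-- **HENCE `hess V X Y W = −Σ_{p∈W} Re tr[(d_V Y)(p)·(d_V X)(p)]` AT A FLAT `V`** on every window of genuine plaquettes — the quadratic form the
flat Landau lift is orthogonal for ((R⊥)) and the slice solver inverts ((1.115) TYPE). [folklore] -/
theorem hess_flat {V : Site d → Fin d → (Matrix n n ℂ)ˣ} (hV0 : SmallField V 0) (X Y : Site d → Fin d → Matrix n n ℂ)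
    (W : Finset (T4AveragingDeficitWall.Plaq d)) : hess V X Y W = -∑ p ∈ W, nReTr (curl V Y p * curl V X p) := by
  unfold hess hessPlaq
  rw [← Finset.sum_neg_distrib]
  refine Finset.sum_congr rfl fun p _ => ?_
  exact hessPlaqAt_flat hV0 X Y p.1 (ne_of_lt p.2.2)

/-- `curlAt` is additive in the direction field, pointwise form for `A = X + N`. [folklore] -/
theorem curlAt_eq_add_of_split (V : Site d → Fin d → (Matrix n n ℂ)ˣ) {A X N : Site d → Fin d → Matrix n n ℂ}
    (h : ∀ y κ, A y κ = X y κ + N y κ) (z : Site d) (μ ν : Fin d) : curlAt V A z μ ν = curlAt V X z μ ν + curlAt V N z μ ν := by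
  have hA : A = X + N := by funext y κ; exact h y κ
  rw [hA, curlAt_add]

/-! ## §2 THE POINTWISE BOOTSTRAP at the representative `Ũ = F̃e^{A}` (B11 Sect. F (159)–(167), flat reference, torus-global) -/

/-- **(APE) AT THE REPRESENTATIVE, FROM THE FLAT LETTERS** — the composition of [Balaban1985Variational] Sect. F at a FLAT reference
`F̃` (`SmallField F̃ 0`), torus-global.  Data: `Ũ = F̃e^{A}`, `A` skew `P`-periodic with `‖A‖ ≤ α₀`; the NORMAL PART `A_N` (the image of the
linearised average `D_{F̃}A` under the hess-ORTHOGONAL exact lift — letters `hNexact` (same linearised average as `A`), `hN7` (its dressed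
curl is `≤ c_N`: the (R7) OUTPUT), `hNorth` (`hess F̃ A_N Y = 0` for every tangent `Y`: the (R⊥) OUTPUT)); the TANGENT PART `A − A_N` lies in the
gauge slice `S` (`hTS`, the B8 Thm 2 TYPE gauge condition); the SLICE SOLVER letter `hG` ((1.115)∕Cor. 2.8 TYPE at `U = 1`: an `(ℓ¹)*`-source of
density `g` on the tangent space forces `sup‖d_{F̃}X‖ ≤ K_G·g` for `X ∈ S ∩ T(F̃)`); the EXPANSION letter `hEXP` (first variation at `Ũ` = Hessian
at `F̃` up to an `(ℓ¹)*`-remainder of density `ρ`); CRITICALITY of `Ũ` on `T(Ũ)` (`hcrit`) and the TEST-FIELD TRANSPORT letter `hTT` (every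
tangent `Y` at `F̃` has a tangent `Y′` at `Ũ` with `|dAction Ũ (Y′ − Y)| ≤ τ·‖Y‖_{ℓ¹}`).  CONCLUSION: `SmallField Ũ (K_G(τ + ρ) + c_N + 28α₀²)`.
PROOF: `X := A − A_N ∈ S ∩ T(F̃)` (`dirIter_sub`); for tangent `Y`: `hess F̃ X Y = hess F̃ A Y` (`hNorth`), `|hess F̃ A Y| ≤ |dAction Ũ Y| + ρ‖Y‖₁`
(`hEXP`), `dAction Ũ Y = dAction Ũ Y′ − dAction Ũ (Y′ − Y) = −dAction Ũ (Y′ − Y)` (`hcrit`), so the source density is `τ + ρ`; `hG` bounds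
`d_{F̃}X`, `hN7` bounds `d_{F̃}A_N`, and the flat Taylor bound `norm_hol_vary_flat_sub_one_le` converts `d_{F̃}A` into plaquettes. [folklore] -/
theorem smallField_vary_of_flatLetters [Nonempty n] {L : ℕ} (hL : 1 ≤ L) (k : ℕ) {P : ℕ}
    {Ft : Site d → Fin d → (Matrix n n ℂ)ˣ} (hFt : IsUnitaryCfg Ft) (hFt0 : SmallField Ft 0)
    {x : ℝ} (hx : 0 ≤ x) (hs : LevelSmall d L k x) (hFtx : SmallField Ft x)
    {A : Site d → Fin d → Matrix n n ℂ} (hA : IsSkewDir A) (hAP : IsPeriodicDir A (P : ℤ)) {α₀ : ℝ} (hAα : ∀ y μ, ‖A y μ‖ ≤ α₀)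
    -- the normal part: exactness, (R7) output, (R⊥) output
    {AN : Site d → Fin d → Matrix n n ℂ} (hNs : IsSkewDir AN) (hNP : IsPeriodicDir AN (P : ℤ))
    (hNexact : dirIter L (k + 1) Ft AN = dirIter L (k + 1) Ft A)
    {cN : ℝ} (hN7 : ∀ z μ ν, μ ≠ ν → ‖curlAt Ft AN z μ ν‖ ≤ cN)
    (hNorth : ∀ Y : Site d → Fin d → Matrix n n ℂ, IsSkewDir Y → IsPeriodicDir Y (P : ℤ) → dirIter L (k + 1) Ft Y = 0 →
      hess Ft AN Y (perWin d P) = 0)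
    -- the gauge slice and the slice solver letter
    (S : Set (Site d → Fin d → Matrix n n ℂ)) (hTS : (fun y μ => A y μ - AN y μ) ∈ S) {KG : ℝ}
    (hG : ∀ X ∈ S, IsSkewDir X → IsPeriodicDir X (P : ℤ) → dirIter L (k + 1) Ft X = 0 → ∀ g : ℝ, 0 ≤ g →
      (∀ Y : Site d → Fin d → Matrix n n ℂ, IsSkewDir Y → IsPeriodicDir Y (P : ℤ) → dirIter L (k + 1) Ft Y = 0 →
        |hess Ft X Y (perWin d P)| ≤ g * dirL1 Y (periodBox (d := d) P)) →
      ∀ z μ ν, μ ≠ ν → ‖curlAt Ft X z μ ν‖ ≤ KG * g)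
    -- the expansion letter
    {ρ : ℝ} (hρ : 0 ≤ ρ)
    (hEXP : ∀ Y : Site d → Fin d → Matrix n n ℂ, IsSkewDir Y → IsPeriodicDir Y (P : ℤ) →
      |dAction (vary Ft A 1) Y (perWin d P) - hess Ft A Y (perWin d P)| ≤ ρ * dirL1 Y (periodBox (d := d) P))
    -- criticality at the representative and the test-field transport letter
    (hcrit : ∀ Y' : Site d → Fin d → Matrix n n ℂ, IsSkewDir Y' → IsPeriodicDir Y' (P : ℤ) → dirIter L (k + 1) (vary Ft A 1) Y' = 0 →
      dAction (vary Ft A 1) Y' (perWin d P) = 0)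
    {τ : ℝ} (hτ : 0 ≤ τ)
    (hTT : ∀ Y : Site d → Fin d → Matrix n n ℂ, IsSkewDir Y → IsPeriodicDir Y (P : ℤ) → dirIter L (k + 1) Ft Y = 0 →
      ∃ Y' : Site d → Fin d → Matrix n n ℂ, IsSkewDir Y' ∧ IsPeriodicDir Y' (P : ℤ) ∧ dirIter L (k + 1) (vary Ft A 1) Y' = 0 ∧
        |dAction (vary Ft A 1) (fun y μ => Y' y μ - Y y μ) (perWin d P)| ≤ τ * dirL1 Y (periodBox (d := d) P)) :
    SmallField (vary Ft A 1) (KG * (τ + ρ) + cN + 28 * α₀ ^ 2) := by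
  -- the tangent part
  set X : Site d → Fin d → Matrix n n ℂ := fun y μ => A y μ - AN y μ with hXdef
  have hXs : IsSkewDir X := fun y μ => (skewAdjoint (Matrix n n ℂ)).sub_mem (hA y μ) (hNs y μ)
  have hXP : IsPeriodicDir X (P : ℤ) := fun y i μ => by simp only [hXdef, hAP y i μ, hNP y i μ]
  have hXT : dirIter L (k + 1) Ft X = 0 := by
    rw [hXdef, dirIter_sub hL k hFt hx hs hFtx A AN, hNexact]
    funext z κ
    simp
  -- the source density on the tangent space
  have hsrc : ∀ Y : Site d → Fin d → Matrix n n ℂ, IsSkewDir Y → IsPeriodicDir Y (P : ℤ) → dirIter L (k + 1) Ft Y = 0 →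
      |hess Ft X Y (perWin d P)| ≤ (τ + ρ) * dirL1 Y (periodBox (d := d) P) := by
    intro Y hY hYP hYT
    -- hess F̃ X Y = hess F̃ A Y
    have hsplitA : A = X + AN := by funext y μ; simp [hXdef]
    have hhess : hess Ft X Y (perWin d P) = hess Ft A Y (perWin d P) := by
      have h := hess_add_left Ft (perWin d P) X AN Y
      rw [← hsplitA, hNorth Y hY hYP hYT, add_zero] at h
      exact h.symm
    -- criticality through the transported test field
    obtain ⟨Y', hY's, hY'P, hY'T, hY'd⟩ := hTT Y hY hYP hYT
    have hc := hcrit Y' hY's hY'P hY'T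
    have hdec : dAction (vary Ft A 1) Y (perWin d P)
        = dAction (vary Ft A 1) Y' (perWin d P) - dAction (vary Ft A 1) (fun y μ => Y' y μ - Y y μ) (perWin d P) := by
      have hYsum : Y' = Y + fun y μ => Y' y μ - Y y μ := by funext y μ; simp
      have h := dAction_add (vary Ft A 1) Y (fun y μ => Y' y μ - Y y μ) (perWin d P)
      rw [← hYsum] at h
      linarith
    have hdA : |dAction (vary Ft A 1) Y (perWin d P)| ≤ τ * dirL1 Y (periodBox (d := d) P) := by
      rw [hdec, hc, zero_sub, abs_neg]
      exact hY'd
    have hE := hEXP Y hY hYP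
    have htri : |hess Ft A Y (perWin d P)| ≤ |dAction (vary Ft A 1) Y (perWin d P)|
        + |dAction (vary Ft A 1) Y (perWin d P) - hess Ft A Y (perWin d P)| := by
      have := abs_sub_abs_le_abs_sub (hess Ft A Y (perWin d P)) (dAction (vary Ft A 1) Y (perWin d P))
      rw [abs_sub_comm] at this
      linarith
    rw [hhess]
    calc |hess Ft A Y (perWin d P)| ≤ τ * dirL1 Y (periodBox (d := d) P) + ρ * dirL1 Y (periodBox (d := d) P) := by linarith
      _ = (τ + ρ) * dirL1 Y (periodBox (d := d) P) := by ring
  -- the slice solver bounds the tangent part's curl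
  have hcurlX : ∀ z μ ν, μ ≠ ν → ‖curlAt Ft X z μ ν‖ ≤ KG * (τ + ρ) :=
    hG X hTS hXs hXP hXT (τ + ρ) (add_nonneg hτ hρ) hsrc
  -- the curl of `A`
  have hcurlA : ∀ z μ ν, μ ≠ ν → ‖curlAt Ft A z μ ν‖ ≤ KG * (τ + ρ) + cN := by
    intro z μ ν hμν
    have hsplit : ∀ y κ, A y κ = X y κ + AN y κ := fun y κ => by simp [hXdef]
    rw [curlAt_eq_add_of_split Ft hsplit z μ ν]
    exact (norm_add_le _ _).trans (add_le_add (hcurlX z μ ν hμν) (hN7 z μ ν hμν))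
  -- plaquettes
  intro z μ ν hμν
  have h := norm_hol_vary_flat_sub_one_le hFt hFt0 hA hAα z hμν
  linarith [hcurlA z μ ν hμν]

/-! ## §3 Back through the gauge, and the currencies (every `M = L^{k+1}` cancels) -/

/-- **(APE) AT THE CRITICAL CONFIGURATION THROUGH THE GAUGE**: if `U^u = F̃e^{A}` (`u` unitary) then §2's plaquette radius is `U`'s
(plaquette variables are conjugated: F26's `smallField_of_gaugeAct_eq`). [folklore] -/
theorem smallField_of_flatLetters_gauge [Nonempty n] {L : ℕ} (hL : 1 ≤ L) (k : ℕ) {P : ℕ}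
    {Ft : Site d → Fin d → (Matrix n n ℂ)ˣ} (hFt : IsUnitaryCfg Ft) (hFt0 : SmallField Ft 0)
    {x : ℝ} (hx : 0 ≤ x) (hs : LevelSmall d L k x) (hFtx : SmallField Ft x)
    {A : Site d → Fin d → Matrix n n ℂ} (hA : IsSkewDir A) (hAP : IsPeriodicDir A (P : ℤ)) {α₀ : ℝ} (hAα : ∀ y μ, ‖A y μ‖ ≤ α₀)
    {U : Site d → Fin d → (Matrix n n ℂ)ˣ} {u : Site d → (Matrix n n ℂ)ˣ} (hu : IsUnitarySite u) (hgauge : gaugeAct u U = vary Ft A 1)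
    {AN : Site d → Fin d → Matrix n n ℂ} (hNs : IsSkewDir AN) (hNP : IsPeriodicDir AN (P : ℤ))
    (hNexact : dirIter L (k + 1) Ft AN = dirIter L (k + 1) Ft A)
    {cN : ℝ} (hN7 : ∀ z μ ν, μ ≠ ν → ‖curlAt Ft AN z μ ν‖ ≤ cN)
    (hNorth : ∀ Y : Site d → Fin d → Matrix n n ℂ, IsSkewDir Y → IsPeriodicDir Y (P : ℤ) → dirIter L (k + 1) Ft Y = 0 →
      hess Ft AN Y (perWin d P) = 0)
    (S : Set (Site d → Fin d → Matrix n n ℂ)) (hTS : (fun y μ => A y μ - AN y μ) ∈ S) {KG : ℝ}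
    (hG : ∀ X ∈ S, IsSkewDir X → IsPeriodicDir X (P : ℤ) → dirIter L (k + 1) Ft X = 0 → ∀ g : ℝ, 0 ≤ g →
      (∀ Y : Site d → Fin d → Matrix n n ℂ, IsSkewDir Y → IsPeriodicDir Y (P : ℤ) → dirIter L (k + 1) Ft Y = 0 →
        |hess Ft X Y (perWin d P)| ≤ g * dirL1 Y (periodBox (d := d) P)) →
      ∀ z μ ν, μ ≠ ν → ‖curlAt Ft X z μ ν‖ ≤ KG * g)
    {ρ : ℝ} (hρ : 0 ≤ ρ)
    (hEXP : ∀ Y : Site d → Fin d → Matrix n n ℂ, IsSkewDir Y → IsPeriodicDir Y (P : ℤ) →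
      |dAction (vary Ft A 1) Y (perWin d P) - hess Ft A Y (perWin d P)| ≤ ρ * dirL1 Y (periodBox (d := d) P))
    (hcrit : ∀ Y' : Site d → Fin d → Matrix n n ℂ, IsSkewDir Y' → IsPeriodicDir Y' (P : ℤ) → dirIter L (k + 1) (vary Ft A 1) Y' = 0 →
      dAction (vary Ft A 1) Y' (perWin d P) = 0)
    {τ : ℝ} (hτ : 0 ≤ τ)
    (hTT : ∀ Y : Site d → Fin d → Matrix n n ℂ, IsSkewDir Y → IsPeriodicDir Y (P : ℤ) → dirIter L (k + 1) Ft Y = 0 →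
      ∃ Y' : Site d → Fin d → Matrix n n ℂ, IsSkewDir Y' ∧ IsPeriodicDir Y' (P : ℤ) ∧ dirIter L (k + 1) (vary Ft A 1) Y' = 0 ∧
        |dAction (vary Ft A 1) (fun y μ => Y' y μ - Y y μ) (perWin d P)| ≤ τ * dirL1 Y (periodBox (d := d) P)) :
    SmallField U (KG * (τ + ρ) + cN + 28 * α₀ ^ 2) :=
  smallField_of_gaugeAct_eq hu hgauge
    (smallField_vary_of_flatLetters hL k hFt hFt0 hx hs hFtx hA hAP hAα hNs hNP hNexact hN7 hNorth S hTS hG hρ hEXP hcrit hτ hTT)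

/-- **THE CURRENCIES**: with `M = L^{k+1}`, the slice solver constant `K_G = K·M` ((1.115) TYPE: one derivative of a Green's function of mass
`∼ M⁻¹`), the transport and expansion densities `τ ≤ τ̂·M⁻³`, `ρ ≤ ρ̂·M⁻³`, the normal curl `c_N ≤ C_R·ĝ·M⁻²` ((R7): `M⁻²` times the coarse
curvature `ĝ`) and the sup size `0 ≤ α₀ ≤ α̂·M⁻¹` (B8 Thm 2 TYPE), the radius of §2 is `≤ (K(τ̂ + ρ̂) + C_R·ĝ + 28α̂²)·M⁻²` — EVERY `M` CANCELS,
the bound is k-UNIFORM in shape. [folklore] -/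
theorem radius_currency {M K KG τ ρ τh ρh cN CR gh α₀ αh : ℝ} (hM : 0 < M) (hK : 0 ≤ K) (hKG : KG = K * M)
    (hτh : τ ≤ τh / M ^ 3) (hρh : ρ ≤ ρh / M ^ 3) (hcN : cN ≤ CR * gh / M ^ 2)
    (hα₀ : 0 ≤ α₀) (hαh : α₀ ≤ αh / M) :
    KG * (τ + ρ) + cN + 28 * α₀ ^ 2 ≤ (K * (τh + ρh) + CR * gh + 28 * αh ^ 2) / M ^ 2 := by
  have hM2 : 0 < M ^ 2 := by positivity
  have h1 : KG * (τ + ρ) ≤ K * (τh + ρh) / M ^ 2 := by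
    rw [hKG]
    have hsum : τ + ρ ≤ (τh + ρh) / M ^ 3 := by rw [add_div]; exact add_le_add hτh hρh
    calc K * M * (τ + ρ) ≤ K * M * ((τh + ρh) / M ^ 3) := mul_le_mul_of_nonneg_left hsum (by positivity)
      _ = K * (τh + ρh) / M ^ 2 := by field_simp
  have h2 : 28 * α₀ ^ 2 ≤ 28 * αh ^ 2 / M ^ 2 := by
    have : α₀ ^ 2 ≤ (αh / M) ^ 2 := pow_le_pow_left₀ hα₀ hαh 2
    rw [div_pow] at this
    have h28 : 28 * α₀ ^ 2 ≤ 28 * (αh ^ 2 / M ^ 2) := by linarith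
    calc 28 * α₀ ^ 2 ≤ 28 * (αh ^ 2 / M ^ 2) := h28
      _ = 28 * αh ^ 2 / M ^ 2 := by ring
  calc KG * (τ + ρ) + cN + 28 * α₀ ^ 2 ≤ K * (τh + ρh) / M ^ 2 + CR * gh / M ^ 2 + 28 * αh ^ 2 / M ^ 2 := by linarith
    _ = (K * (τh + ρh) + CR * gh + 28 * αh ^ 2) / M ^ 2 := by ring

/-! ## §4 THE END: F29∕F31's `hape` hypothesis from the flat letters on the data class `𝒟_β` -/

/-- **(APE) ON THE DATA CLASS `𝒟_β` FROM THE FLAT LETTERS** — exactly the `hape` hypothesis of F31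
`NE7OneStepOfRoutePi.oneStep_of_dataClass_ape_routePi` (and of F29∕F33), generic `d`, `L ≥ 1`, every `N`.  For every datum `D ∈ 𝒟_β`, every
level `k+1` and every tangent-critical admissible `U` with `SmallField U (δM⁻²)` the letter bundle `hletters` supplies: a FLAT reference `F̃` in
the class radius (`SmallField F̃ 0`, the flat lift of F29's nearby flat datum), a unitary gauge `u` and the representative `A` (`U^u = F̃e^{A}`,
skew periodic, `‖A‖ ≤ α₀ ≤ α̂M⁻¹`, criticality transported to the representative — B8 Thm 2 TYPE, the shared leaf Π-L1♮ read at the pair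
`(F̃, U)`), its normal part `A_N` (exactness, the (R7) output `c_N ≤ C_R·ĝ·M⁻²`, the (R⊥) output — the flat Landau lift, F36∕F37 at `F̃ = 1`), the
gauge slice `S` with the slice solver letter at constant `K·M` ((1.115)∕Cor. 2.8 TYPE at `U = 1`), the expansion letter `ρ ≤ ρ̂M⁻³` and the
test-field transport letter `τ ≤ τ̂M⁻³`; `δ₁ = K(τ̂ + ρ̂) + C_R·ĝ + 28α̂²`.  NOTHING of the bundle is proved here. [folklore] -/
theorem hape_of_flatLetters [Nonempty n] {L N : ℕ} (hL : 1 ≤ L) {ε δ δ₁ β K τh ρh CR gh αh : ℝ} (hK : 0 ≤ K)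
    (hδ₁ : K * (τh + ρh) + CR * gh + 28 * αh ^ 2 ≤ δ₁)
    (hletters : ∀ D : Site d → Fin d → (Matrix n n ℂ)ˣ, IsUnitaryCfg D → IsPeriodicCfg D (N : ℤ) → SmallField D (4 * (Real.exp β - 1)) →
      ∀ (k : ℕ), ∀ U ∈ admissible (sfClass d L N ε) L (k + 1) D, SmallField U (δ / ((L : ℝ) ^ (k + 1)) ^ 2) →
      (∀ φ : Site d → Fin d → Matrix n n ℂ, IsSkewDir φ → IsPeriodicDir φ ((N * L ^ (k + 1) : ℕ) : ℤ) → TangentIter L k U φ →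
        dAction U φ (perWin d (N * L ^ (k + 1))) = 0) →
      ∃ (Ft : Site d → Fin d → (Matrix n n ℂ)ˣ) (x : ℝ) (u : Site d → (Matrix n n ℂ)ˣ) (A AN : Site d → Fin d → Matrix n n ℂ)
        (S : Set (Site d → Fin d → Matrix n n ℂ)) (α₀ cN ρ τ : ℝ),
        -- the flat reference in the class radius
        IsUnitaryCfg Ft ∧ SmallField Ft 0 ∧ 0 ≤ x ∧ LevelSmall d L k x ∧ SmallField Ft x ∧
        -- the representative (B8 Thm 2 TYPE) and criticality at the representative
        IsUnitarySite u ∧ gaugeAct u U = vary Ft A 1 ∧ IsSkewDir A ∧ IsPeriodicDir A ((N * L ^ (k + 1) : ℕ) : ℤ) ∧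
        (∀ y μ, ‖A y μ‖ ≤ α₀) ∧ 0 ≤ α₀ ∧ α₀ ≤ αh / (L : ℝ) ^ (k + 1) ∧
        (∀ Y' : Site d → Fin d → Matrix n n ℂ, IsSkewDir Y' → IsPeriodicDir Y' ((N * L ^ (k + 1) : ℕ) : ℤ) →
          dirIter L (k + 1) (vary Ft A 1) Y' = 0 → dAction (vary Ft A 1) Y' (perWin d (N * L ^ (k + 1))) = 0) ∧
        -- the normal part (flat Landau lift of `D_{F̃}A`): exactness, (R7) output, (R⊥) output
        IsSkewDir AN ∧ IsPeriodicDir AN ((N * L ^ (k + 1) : ℕ) : ℤ) ∧ dirIter L (k + 1) Ft AN = dirIter L (k + 1) Ft A ∧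
        (∀ z μ ν, μ ≠ ν → ‖curlAt Ft AN z μ ν‖ ≤ cN) ∧ cN ≤ CR * gh / ((L : ℝ) ^ (k + 1)) ^ 2 ∧
        (∀ Y : Site d → Fin d → Matrix n n ℂ, IsSkewDir Y → IsPeriodicDir Y ((N * L ^ (k + 1) : ℕ) : ℤ) → dirIter L (k + 1) Ft Y = 0 →
          hess Ft AN Y (perWin d (N * L ^ (k + 1))) = 0) ∧
        -- the gauge slice and the slice solver letter at constant `K·M`
        (fun y μ => A y μ - AN y μ) ∈ S ∧
        (∀ X ∈ S, IsSkewDir X → IsPeriodicDir X ((N * L ^ (k + 1) : ℕ) : ℤ) → dirIter L (k + 1) Ft X = 0 → ∀ g : ℝ, 0 ≤ g →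
          (∀ Y : Site d → Fin d → Matrix n n ℂ, IsSkewDir Y → IsPeriodicDir Y ((N * L ^ (k + 1) : ℕ) : ℤ) → dirIter L (k + 1) Ft Y = 0 →
            |hess Ft X Y (perWin d (N * L ^ (k + 1)))| ≤ g * dirL1 Y (periodBox (d := d) (N * L ^ (k + 1)))) →
          ∀ z μ ν, μ ≠ ν → ‖curlAt Ft X z μ ν‖ ≤ K * (L : ℝ) ^ (k + 1) * g) ∧
        -- the expansion letter and the test-field transport letter
        0 ≤ ρ ∧ ρ ≤ ρh / ((L : ℝ) ^ (k + 1)) ^ 3 ∧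
        (∀ Y : Site d → Fin d → Matrix n n ℂ, IsSkewDir Y → IsPeriodicDir Y ((N * L ^ (k + 1) : ℕ) : ℤ) →
          |dAction (vary Ft A 1) Y (perWin d (N * L ^ (k + 1))) - hess Ft A Y (perWin d (N * L ^ (k + 1)))|
            ≤ ρ * dirL1 Y (periodBox (d := d) (N * L ^ (k + 1)))) ∧
        0 ≤ τ ∧ τ ≤ τh / ((L : ℝ) ^ (k + 1)) ^ 3 ∧
        (∀ Y : Site d → Fin d → Matrix n n ℂ, IsSkewDir Y → IsPeriodicDir Y ((N * L ^ (k + 1) : ℕ) : ℤ) → dirIter L (k + 1) Ft Y = 0 →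
          ∃ Y' : Site d → Fin d → Matrix n n ℂ, IsSkewDir Y' ∧ IsPeriodicDir Y' ((N * L ^ (k + 1) : ℕ) : ℤ) ∧
            dirIter L (k + 1) (vary Ft A 1) Y' = 0 ∧
            |dAction (vary Ft A 1) (fun y μ => Y' y μ - Y y μ) (perWin d (N * L ^ (k + 1)))|
              ≤ τ * dirL1 Y (periodBox (d := d) (N * L ^ (k + 1)))))
    : ∀ D : Site d → Fin d → (Matrix n n ℂ)ˣ, IsUnitaryCfg D → IsPeriodicCfg D (N : ℤ) → SmallField D (4 * (Real.exp β - 1)) →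
      ∀ (k : ℕ), ∀ U ∈ admissible (sfClass d L N ε) L (k + 1) D, SmallField U (δ / ((L : ℝ) ^ (k + 1)) ^ 2) →
      (∀ φ : Site d → Fin d → Matrix n n ℂ, IsSkewDir φ → IsPeriodicDir φ ((N * L ^ (k + 1) : ℕ) : ℤ) → TangentIter L k U φ →
        dAction U φ (perWin d (N * L ^ (k + 1))) = 0) → SmallField U (δ₁ / ((L : ℝ) ^ (k + 1)) ^ 2) := by
  intro D hDu hDP hDs k U hU hUδ hcritU
  obtain ⟨Ft, x, u, A, AN, S, α₀, cN, ρ, τ, hFt, hFt0, hx, hs, hFtx, hu, hgauge, hA, hAP, hAα, hα₀, hαh, hcrit, hNs, hNP, hNexact,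
    hN7, hcN, hNorth, hTS, hG, hρ, hρh, hEXP, hτ, hτh, hTT⟩ := hletters D hDu hDP hDs k U hU hUδ hcritU
  have hM : 0 < (L : ℝ) ^ (k + 1) := pow_pos (by exact_mod_cast hL) _
  have h := smallField_of_flatLetters_gauge (P := N * L ^ (k + 1)) hL k hFt hFt0 hx hs hFtx hA hAP hAα hu hgauge hNs hNP hNexact hN7
    hNorth S hTS hG hρ hEXP hcrit hτ hTT
  have hcur := radius_currency (K := K) hM hK rfl hτh hρh hcN hα₀ hαh
  exact SmallField.mono (SmallField.mono h hcur) (div_le_div_of_nonneg_right hδ₁ (by positivity))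

end

end Summit.QuantumFields.BalabanUV.T4Continuum.NE7ApeFlatSkeleton
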